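import Summits.Parity.GeneralizedHardyLittlewood.Theorems.PrimeLevelFamEdgeMomentsBeyondDiagonalDiagLineTailGeom
import Summits.Parity.GeneralizedHardyLittlewood.Theorems.PrimeLevelFamEdgeMomentsBeyondDiagonalDiagLineSeries
import HarnessLib

/-!
# Route `PrimeLevelFamEdge`, crux K_A `MomentsBeyondDiagonal` (stmt-Parity-20007), line «petersson_layers» v4, stub `stub_diag`:
# THE BOX TAIL OF ONE ORDER-`(i,j)` BLOCK — summed over mollifier pairs and Hecke divisors

`…DiagLineSeries` (p811381): `diagPart = Σ_{i,j} QᵢQⱼℓ^{−(i+j)}(1+(−1)^{i+j}) q̂ · BLOCK_{ij}`, `BLOCK_{ij} = Σ_{m₁,m₂ ≤ M} x_{m₁}x_{m₂}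
Σ_{d₁∣m₁,d₂∣m₂} c (m₁m₂)^{−1/2}(𝔚_{ij} − tail)`. With the per-line bound `…DiagLineTailGeom.abs_lineTail_le_geom` (p811661), uniform in
`(m₁,m₂,d₁,d₂)`, the tail part of a block is bounded by elementary counting (`c ≤ m₁ ≤ M`, `(m₁m₂)^{−1/2} ≤ 1`, `#(d₁,d₂) = τ(m₁)τ(m₂)`):

* `norm_blockTail_le` — `‖Σ_{m₁,m₂ ≤ M} x_{m₁}x_{m₂} Σ_{d₁∣m₁,d₂∣m₂} c (m₁m₂)^{−1/2} · tail(m,d)‖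
     ≤ (Σ_{m ≤ M} |x_m| τ(m))² · M · C_A(i)C_A(j) ζ₂ (1 + log q̂ + 2 log M)^{i+j} (q̂²M²/q⁴)^A (q²+1)^{i+j+1}`   (`q̂ ≥ 1`, `M ≥ 1`, `2A ≥ i+j+1`);
* `norm_diagPart_sub_lineSeries_le` — **`‖diagPart − LINE SERIES‖ ≤ Σ_{i,j ≤ deg Q} |Qᵢ||Qⱼ| ℓ^{−(i+j)} · 2q̂ · (block bound)_{ij}`**
  (`q̂ ≥ 1`, `M = q̂^{Δ'} ≥ 1`, `2A ≥ 2 deg Q + 1`): the box tail of the diagonal part, structurally bounded.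

What is left of census R1 after this file: multiply by `|QᵢQⱼ|ℓ^{−(i+j)}·2q̂`, use `|x_m|τ(m) ≤ B_P m^{1/2}`, `M = q̂^{Δ'} ≤ q^{3/4}`, `q̂² ≤ q`
and pick `A = 4 deg Q + 5`: the whole box tail of `diagPart` is `O_{P,Q}(1)` (indeed `O(q^{−1})`) on `Δ' ≤ 3/2`. Helper
`--supports stmt-Parity-20007`; closes nothing; K_A, K_B and the Parity summit are NOT proved; nothing about Landau–Siegel zeros.
-/

noncomputable section

open scoped Real
open Complex Finset MeasureTheory Polynomial
open Literature.NumberTheory.LFunctions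

namespace Summit.Parity.GeneralizedHardyLittlewood.Theorems.MomentsBeyondDiagonal.DiagLines

open Summit.Parity.GeneralizedHardyLittlewood.Theorems.PrimeLevelFamEdgeIdeaDeltas.PeterssonLayers (diagPart)

/-- Generic: a double finite sum whose terms are bounded by `B` has norm `≤ #s · #t · B`. -/
theorem norm_sum_sum_le_card_mul {s t : Finset ℕ} {F : ℕ → ℕ → ℂ} {B : ℝ}
    (h : ∀ d₁ ∈ s, ∀ d₂ ∈ t, ‖F d₁ d₂‖ ≤ B) :
    ‖∑ d₁ ∈ s, ∑ d₂ ∈ t, F d₁ d₂‖ ≤ (s.card : ℝ) * ((t.card : ℝ) * B) := by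
  calc ‖∑ d₁ ∈ s, ∑ d₂ ∈ t, F d₁ d₂‖ ≤ ∑ d₁ ∈ s, ∑ d₂ ∈ t, B := by
        refine (norm_sum_le _ _).trans (Finset.sum_le_sum fun d₁ hd₁ ↦ ?_)
        exact (norm_sum_le _ _).trans (Finset.sum_le_sum fun d₂ hd₂ ↦ h d₁ hd₁ d₂ hd₂)
    _ = (s.card : ℝ) * ((t.card : ℝ) * B) := by simp [Finset.sum_const]

/-- Generic: if `‖G m₁ m₂‖ ≤ a(m₁) a(m₂) B` on `s × s` then `‖Σ_{s×s} G‖ ≤ (Σ_s a)² B`. -/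
theorem norm_sum_sum_le_sq_mul {s : Finset ℕ} {G : ℕ → ℕ → ℂ} {a : ℕ → ℝ} {B : ℝ}
    (h : ∀ m₁ ∈ s, ∀ m₂ ∈ s, ‖G m₁ m₂‖ ≤ a m₁ * a m₂ * B) :
    ‖∑ m₁ ∈ s, ∑ m₂ ∈ s, G m₁ m₂‖ ≤ (∑ m ∈ s, a m) ^ 2 * B := by
  calc ‖∑ m₁ ∈ s, ∑ m₂ ∈ s, G m₁ m₂‖ ≤ ∑ m₁ ∈ s, ∑ m₂ ∈ s, a m₁ * a m₂ * B := by
        refine (norm_sum_le _ _).trans (Finset.sum_le_sum fun m₁ hm₁ ↦ ?_)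
        exact (norm_sum_le _ _).trans (Finset.sum_le_sum fun m₂ hm₂ ↦ h m₁ hm₁ m₂ hm₂)
    _ = (∑ m ∈ s, a m) ^ 2 * B := by
        rw [sq, Finset.sum_mul_sum, Finset.sum_mul]
        refine Finset.sum_congr rfl fun m₁ _ ↦ ?_
        rw [Finset.sum_mul]

/-- **The box tail of one order-`(i,j)` block.** For `q̂ ≥ 1`, `M ≥ 1`, `2A ≥ i+j+1` and any real coefficients `x : ℕ → ℝ`
(in the application `x = KMV2000.mollifierCoeff P M`):
`‖Σ_{m₁,m₂ ∈ [1,⌊M⌋]} x_{m₁}x_{m₂} Σ_{d₁∣m₁} Σ_{d₂∣m₂} c (m₁m₂)^{−1/2} · tail_{ij}(m₁,m₂,d₁,d₂)‖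
   ≤ (Σ_{m ∈ [1,⌊M⌋]} |x_m| τ(m))² · M · [C_A(i)C_A(j) (1+log q̂+2log M)^i (1+log q̂+2log M)^j ζ₂ (q̂²M²/q⁴)^A (q²+1)^{i+j+1}]`.
[cite: KowalskiMichelVanderKam2000, (22)–(23) p. 12–13 — derivation] -/
theorem norm_blockTail_le {q : ℕ} [NeZero q] (hqh : 1 ≤ KMV2000.qhat q) (i j : ℕ) {A : ℝ} (hA : (i + j + 1 : ℝ) ≤ 2 * A)
    {M : ℝ} (hM : 1 ≤ M) (x : ℕ → ℝ) :
    ‖∑ m₁ ∈ Icc 1 ⌊M⌋₊, ∑ m₂ ∈ Icc 1 ⌊M⌋₊, (x m₁ : ℂ) * (x m₂ : ℂ) *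
        ∑ d₁ ∈ m₁.divisors, ∑ d₂ ∈ m₂.divisors,
          (((((m₁ / d₁).gcd (m₂ / d₂) : ℝ) * ((m₁ : ℝ) * m₂) ^ (-(1 / 2 : ℝ)) *
            ∑' l : ℕ, ((l : ℝ) + 1 + (min (q ^ 2 / (d₁ * (m₂ / d₂ / (m₁ / d₁).gcd (m₂ / d₂))))
                (q ^ 2 / (d₂ * (m₁ / d₁ / (m₁ / d₁).gcd (m₂ / d₂)))) : ℕ))⁻¹ *
              KMV2000.logCutoffW i j
                (Real.log (KMV2000.qhat q / ((d₁ * (m₂ / d₂ / (m₁ / d₁).gcd (m₂ / d₂)) : ℕ) : ℝ)) -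
                  Real.log ((l : ℝ) + 1 + (min (q ^ 2 / (d₁ * (m₂ / d₂ / (m₁ / d₁).gcd (m₂ / d₂))))
                    (q ^ 2 / (d₂ * (m₁ / d₁ / (m₁ / d₁).gcd (m₂ / d₂)))) : ℕ)))
                (Real.log (KMV2000.qhat q / ((d₂ * (m₁ / d₁ / (m₁ / d₁).gcd (m₂ / d₂)) : ℕ) : ℝ)) -
                  Real.log ((l : ℝ) + 1 + (min (q ^ 2 / (d₁ * (m₂ / d₂ / (m₁ / d₁).gcd (m₂ / d₂))))
                    (q ^ 2 / (d₂ * (m₁ / d₁ / (m₁ / d₁).gcd (m₂ / d₂)))) : ℕ)))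
                (((((m₁ / (m₁ / d₁).gcd (m₂ / d₂)) * (m₂ / (m₁ / d₁).gcd (m₂ / d₂)) : ℕ) : ℝ) / KMV2000.qhat q ^ 2) *
                  ((l : ℝ) + 1 + (min (q ^ 2 / (d₁ * (m₂ / d₂ / (m₁ / d₁).gcd (m₂ / d₂))))
                    (q ^ 2 / (d₂ * (m₁ / d₁ / (m₁ / d₁).gcd (m₂ / d₂)))) : ℕ)) ^ 2)) : ℝ) : ℂ)‖ ≤
      (∑ m ∈ Icc 1 ⌊M⌋₊, |x m| * (m.divisors.card : ℝ)) ^ 2 * M *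
        (((∫ t in Set.Ioi (0 : ℝ), t ^ A * (Real.exp (-t) * (2 ^ i * (1 + |Real.log t| ^ i)))) *
            ∫ t in Set.Ioi (0 : ℝ), t ^ A * (Real.exp (-t) * (2 ^ j * (1 + |Real.log t| ^ j)))) *
          (1 + Real.log (KMV2000.qhat q) + 2 * Real.log M) ^ i * (1 + Real.log (KMV2000.qhat q) + 2 * Real.log M) ^ j *
          (∑' n : ℕ, (((n : ℝ) + 1) ^ 2)⁻¹) *
          (KMV2000.qhat q ^ 2 * M ^ 2 / ((q : ℝ)) ^ 4) ^ A * (((q : ℝ)) ^ 2 + 1) ^ ((i + j : ℝ) + 1)) := by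
  -- the uniform per-line bound
  set BND : ℝ := ((∫ t in Set.Ioi (0 : ℝ), t ^ A * (Real.exp (-t) * (2 ^ i * (1 + |Real.log t| ^ i)))) *
            ∫ t in Set.Ioi (0 : ℝ), t ^ A * (Real.exp (-t) * (2 ^ j * (1 + |Real.log t| ^ j)))) *
          (1 + Real.log (KMV2000.qhat q) + 2 * Real.log M) ^ i * (1 + Real.log (KMV2000.qhat q) + 2 * Real.log M) ^ j *
          (∑' n : ℕ, (((n : ℝ) + 1) ^ 2)⁻¹) *
          (KMV2000.qhat q ^ 2 * M ^ 2 / ((q : ℝ)) ^ 4) ^ A * (((q : ℝ)) ^ 2 + 1) ^ ((i + j : ℝ) + 1) with hBND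
  have hQ0 : 0 < KMV2000.qhat q := lt_of_lt_of_le one_pos hqh
  have hM0 : 0 < M := by linarith
  have hBND0 : 0 ≤ BND := by
    have h1 : 0 ≤ ∫ t in Set.Ioi (0 : ℝ), t ^ A * (Real.exp (-t) * (2 ^ i * (1 + |Real.log t| ^ i))) :=
      setIntegral_nonneg measurableSet_Ioi fun t ht ↦ by have ht : (0 : ℝ) < t := ht; positivity
    have h2 : 0 ≤ ∫ t in Set.Ioi (0 : ℝ), t ^ A * (Real.exp (-t) * (2 ^ j * (1 + |Real.log t| ^ j))) :=
      setIntegral_nonneg measurableSet_Ioi fun t ht ↦ by have ht : (0 : ℝ) < t := ht; positivity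
    have h3 : 0 ≤ 1 + Real.log (KMV2000.qhat q) + 2 * Real.log M := by
      have := Real.log_nonneg hqh; have := Real.log_nonneg hM; linarith
    have h4 : 0 ≤ ∑' n : ℕ, (((n : ℝ) + 1) ^ 2)⁻¹ := tsum_nonneg fun n ↦ by positivity
    have h5 : 0 ≤ (KMV2000.qhat q ^ 2 * M ^ 2 / ((q : ℝ)) ^ 4) ^ A := Real.rpow_nonneg (by positivity) _
    have h6 : 0 ≤ (((q : ℝ)) ^ 2 + 1) ^ ((i + j : ℝ) + 1) := Real.rpow_nonneg (by positivity) _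
    rw [hBND]
    exact mul_nonneg (mul_nonneg (mul_nonneg (mul_nonneg (mul_nonneg (mul_nonneg h1 h2) (pow_nonneg h3 _))
      (pow_nonneg h3 _)) h4) h5) h6
  -- membership facts
  have hmem : ∀ {m : ℕ}, m ∈ Icc 1 ⌊M⌋₊ → 1 ≤ m ∧ (m : ℝ) ≤ M := by
    intro m hm
    have h := Finset.mem_Icc.mp hm
    exact ⟨h.1, (Nat.cast_le.mpr h.2).trans (Nat.floor_le hM0.le)⟩
  -- per pair
  have hpair : ∀ m₁ ∈ Icc 1 ⌊M⌋₊, ∀ m₂ ∈ Icc 1 ⌊M⌋₊, ∀ d₁ ∈ m₁.divisors, ∀ d₂ ∈ m₂.divisors,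
      ‖(((((m₁ / d₁).gcd (m₂ / d₂) : ℝ) * ((m₁ : ℝ) * m₂) ^ (-(1 / 2 : ℝ)) *
            ∑' l : ℕ, ((l : ℝ) + 1 + (min (q ^ 2 / (d₁ * (m₂ / d₂ / (m₁ / d₁).gcd (m₂ / d₂))))
                (q ^ 2 / (d₂ * (m₁ / d₁ / (m₁ / d₁).gcd (m₂ / d₂)))) : ℕ))⁻¹ *
              KMV2000.logCutoffW i j
                (Real.log (KMV2000.qhat q / ((d₁ * (m₂ / d₂ / (m₁ / d₁).gcd (m₂ / d₂)) : ℕ) : ℝ)) -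
                  Real.log ((l : ℝ) + 1 + (min (q ^ 2 / (d₁ * (m₂ / d₂ / (m₁ / d₁).gcd (m₂ / d₂))))
                    (q ^ 2 / (d₂ * (m₁ / d₁ / (m₁ / d₁).gcd (m₂ / d₂)))) : ℕ)))
                (Real.log (KMV2000.qhat q / ((d₂ * (m₁ / d₁ / (m₁ / d₁).gcd (m₂ / d₂)) : ℕ) : ℝ)) -
                  Real.log ((l : ℝ) + 1 + (min (q ^ 2 / (d₁ * (m₂ / d₂ / (m₁ / d₁).gcd (m₂ / d₂))))
                    (q ^ 2 / (d₂ * (m₁ / d₁ / (m₁ / d₁).gcd (m₂ / d₂)))) : ℕ)))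
                (((((m₁ / (m₁ / d₁).gcd (m₂ / d₂)) * (m₂ / (m₁ / d₁).gcd (m₂ / d₂)) : ℕ) : ℝ) / KMV2000.qhat q ^ 2) *
                  ((l : ℝ) + 1 + (min (q ^ 2 / (d₁ * (m₂ / d₂ / (m₁ / d₁).gcd (m₂ / d₂))))
                    (q ^ 2 / (d₂ * (m₁ / d₁ / (m₁ / d₁).gcd (m₂ / d₂)))) : ℕ)) ^ 2)) : ℝ) : ℂ)‖ ≤ M * BND := by
    intro m₁ hm₁ m₂ hm₂ d₁ hd₁ d₂ hd₂
    obtain ⟨h1₁, h1M⟩ := hmem hm₁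
    obtain ⟨h2₁, h2M⟩ := hmem hm₂
    have hd₁' := (Nat.mem_divisors.mp hd₁).1
    have hd₂' := (Nat.mem_divisors.mp hd₂).1
    have htail := abs_lineTail_le_geom hqh i j hA hM h1₁ h2₁ h1M h2M hd₁' hd₂'
    rw [Complex.norm_real, Real.norm_eq_abs, abs_mul, abs_mul]
    -- `c ≤ m₁ ≤ M`, `(m₁m₂)^{-1/2} ≤ 1`
    have hc : |(((m₁ / d₁).gcd (m₂ / d₂) : ℕ) : ℝ)| ≤ M := by
      rw [abs_of_nonneg (Nat.cast_nonneg _)]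
      have : (m₁ / d₁).gcd (m₂ / d₂) ≤ m₁ :=
        (Nat.le_of_dvd (Nat.pos_of_ne_zero fun h ↦ by
          have := Nat.eq_zero_of_dvd_of_div_eq_zero hd₁' h; omega) (Nat.gcd_dvd_left _ _)).trans (Nat.div_le_self _ _)
      exact le_trans (by exact_mod_cast this) h1M
    have hr : |((m₁ : ℝ) * m₂) ^ (-(1 / 2 : ℝ))| ≤ 1 := by
      have hmm : (1 : ℝ) ≤ (m₁ : ℝ) * m₂ := by
        have : (1 : ℝ) ≤ m₁ := by exact_mod_cast h1₁
        have : (1 : ℝ) ≤ m₂ := by exact_mod_cast h2₁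
        nlinarith
      rw [abs_of_nonneg (Real.rpow_nonneg (by linarith) _)]
      exact Real.rpow_le_one_of_one_le_of_nonpos hmm (by norm_num)
    calc |(((m₁ / d₁).gcd (m₂ / d₂) : ℕ) : ℝ)| * |((m₁ : ℝ) * m₂) ^ (-(1 / 2 : ℝ))| * _
        ≤ M * 1 * BND := by
          refine mul_le_mul (mul_le_mul hc hr (abs_nonneg _) hM0.le) htail (abs_nonneg _) (by positivity)
      _ = M * BND := by ring
  -- sum over divisors, then over pairs
  rw [show (∑ m ∈ Icc 1 ⌊M⌋₊, |x m| * (m.divisors.card : ℝ)) ^ 2 * M * BND =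
      (∑ m ∈ Icc 1 ⌊M⌋₊, |x m| * (m.divisors.card : ℝ)) ^ 2 * (M * BND) by ring]
  refine norm_sum_sum_le_sq_mul fun m₁ hm₁ m₂ hm₂ ↦ ?_
  rw [norm_mul, norm_mul, Complex.norm_real, Complex.norm_real, Real.norm_eq_abs, Real.norm_eq_abs]
  have hsum := norm_sum_sum_le_card_mul fun d₁ hd₁ d₂ hd₂ ↦ hpair m₁ hm₁ m₂ hm₂ d₁ hd₁ d₂ hd₂
  calc |x m₁| * |x m₂| * _ ≤ |x m₁| * |x m₂| * ((m₁.divisors.card : ℝ) * ((m₂.divisors.card : ℝ) * (M * BND))) :=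
        mul_le_mul_of_nonneg_left hsum (by positivity)
    _ = _ := by ring

/-- **THE BOX TAIL OF THE DIAGONAL PART, STRUCTURALLY BOUNDED.** For every level `q` with `q̂ ≥ 1`, all `P, Q`, every `Δ' ≥ 0`
(`M = q̂^{Δ'}`) and `2A ≥ 2 deg Q + 1`:
`‖diagPart q P Q Δ' − (explicit line series)‖ ≤ Σ_{i,j ≤ deg Q} |Qᵢ||Qⱼ| ℓ^{−(i+j)} · 2q̂ · (Σ_{m≤M}|x_m|τ(m))² · M · BND_{ij}(q, M, A)`
with `BND_{ij} = C_A(i)C_A(j)(1+log q̂+2log M)^{i+j} ζ₂ (q̂²M²/q⁴)^A (q²+1)^{i+j+1}` (`…DiagLineTailGeom`). On `Δ' ≤ 3/2` every factor is an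
elementary function of `q` and the right-hand side is `O_{P,Q}(1)` for `A = 4 deg Q + 5` (census R1, last step).
[cite: KowalskiMichelVanderKam2000, (22)–(23) p. 12–13 — derivation] -/
theorem norm_diagPart_sub_lineSeries_le {q : ℕ} [NeZero q] (hqh : 1 ≤ KMV2000.qhat q) (P Q : ℝ[X]) {Δ' : ℝ} (hΔ : 0 ≤ Δ')
    {A : ℝ} (hA : (2 * Q.natDegree + 1 : ℝ) ≤ 2 * A) :
    ‖diagPart q P Q Δ' -
      ∑ i ∈ range (Q.natDegree + 1), ∑ j ∈ range (Q.natDegree + 1),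
        (Q.coeff i : ℂ) * (Q.coeff j : ℂ) * (((Real.log (KMV2000.qhat q))⁻¹ : ℝ) : ℂ) ^ (i + j) *
          (1 + (-1 : ℂ) ^ (i + j)) * (KMV2000.qhat q : ℂ) *
        ∑ m₁ ∈ Icc 1 ⌊KMV2000.qhat q ^ Δ'⌋₊, ∑ m₂ ∈ Icc 1 ⌊KMV2000.qhat q ^ Δ'⌋₊,
          (KMV2000.mollifierCoeff P (KMV2000.qhat q ^ Δ') m₁ : ℂ) *
            (KMV2000.mollifierCoeff P (KMV2000.qhat q ^ Δ') m₂ : ℂ) *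
          ∑ d₁ ∈ m₁.divisors, ∑ d₂ ∈ m₂.divisors,
            (((((m₁ / d₁).gcd (m₂ / d₂) : ℝ) * ((m₁ : ℝ) * m₂) ^ (-(1 / 2 : ℝ)) *
              (∫ u₁ in Set.Ioi (0 : ℝ),
                  (Real.log (KMV2000.qhat q / ((d₁ * (m₂ / d₂ / (m₁ / d₁).gcd (m₂ / d₂)) : ℕ) : ℝ)) + Real.log u₁) ^ i *
                  ∫ u₂ in Set.Ioi (((((m₁ / (m₁ / d₁).gcd (m₂ / d₂)) * (m₂ / (m₁ / d₁).gcd (m₂ / d₂)) : ℕ) : ℝ) /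
                      KMV2000.qhat q ^ 2) / u₁),
                    Real.exp (-(u₁ + u₂)) / (1 - Real.exp (-(u₁ + u₂))) ^ 2 *
                    (Real.log (KMV2000.qhat q / ((d₂ * (m₁ / d₁ / (m₁ / d₁).gcd (m₂ / d₂)) : ℕ) : ℝ)) + Real.log u₂) ^ j)) : ℝ) : ℂ)‖ ≤
      ∑ i ∈ range (Q.natDegree + 1), ∑ j ∈ range (Q.natDegree + 1),
        |Q.coeff i| * |Q.coeff j| * (Real.log (KMV2000.qhat q))⁻¹ ^ (i + j) * 2 * KMV2000.qhat q *
        ((∑ m ∈ Icc 1 ⌊KMV2000.qhat q ^ Δ'⌋₊, |KMV2000.mollifierCoeff P (KMV2000.qhat q ^ Δ') m| * (m.divisors.card : ℝ)) ^ 2 *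
          KMV2000.qhat q ^ Δ' *
        (((∫ t in Set.Ioi (0 : ℝ), t ^ A * (Real.exp (-t) * (2 ^ i * (1 + |Real.log t| ^ i)))) *
            ∫ t in Set.Ioi (0 : ℝ), t ^ A * (Real.exp (-t) * (2 ^ j * (1 + |Real.log t| ^ j)))) *
          (1 + Real.log (KMV2000.qhat q) + 2 * Real.log (KMV2000.qhat q ^ Δ')) ^ i *
            (1 + Real.log (KMV2000.qhat q) + 2 * Real.log (KMV2000.qhat q ^ Δ')) ^ j *
          (∑' n : ℕ, (((n : ℝ) + 1) ^ 2)⁻¹) *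
          (KMV2000.qhat q ^ 2 * (KMV2000.qhat q ^ Δ') ^ 2 / ((q : ℝ)) ^ 4) ^ A * (((q : ℝ)) ^ 2 + 1) ^ ((i + j : ℝ) + 1))) := by
  have hQ0 : 0 < KMV2000.qhat q := lt_of_lt_of_le one_pos hqh
  have hM : 1 ≤ KMV2000.qhat q ^ Δ' := Real.one_le_rpow hqh hΔ
  have hlog : 0 ≤ (Real.log (KMV2000.qhat q))⁻¹ := inv_nonneg.mpr (Real.log_nonneg hqh)
  rw [diagPart_eq_lineSeries_sub_tail, ← Finset.sum_sub_distrib]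
  refine (norm_sum_le _ _).trans (Finset.sum_le_sum fun i hi ↦ ?_)
  rw [← Finset.sum_sub_distrib]
  refine (norm_sum_le _ _).trans (Finset.sum_le_sum fun j hj ↦ ?_)
  have hi' : i ≤ Q.natDegree := Nat.lt_succ_iff.mp (Finset.mem_range.mp hi)
  have hj' : j ≤ Q.natDegree := Nat.lt_succ_iff.mp (Finset.mem_range.mp hj)
  have hAij : (i + j + 1 : ℝ) ≤ 2 * A := by
    have : (i : ℝ) ≤ Q.natDegree := by exact_mod_cast hi'
    have : (j : ℝ) ≤ Q.natDegree := by exact_mod_cast hj'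
    linarith
  rw [← mul_sub, ← Finset.sum_sub_distrib]
  -- the inner difference is minus the block tail
  have hdiff : ∑ m₁ ∈ Icc 1 ⌊KMV2000.qhat q ^ Δ'⌋₊, (∑ m₂ ∈ Icc 1 ⌊KMV2000.qhat q ^ Δ'⌋₊,
          (KMV2000.mollifierCoeff P (KMV2000.qhat q ^ Δ') m₁ : ℂ) *
            (KMV2000.mollifierCoeff P (KMV2000.qhat q ^ Δ') m₂ : ℂ) *
          ∑ d₁ ∈ m₁.divisors, ∑ d₂ ∈ m₂.divisors,
            (((((m₁ / d₁).gcd (m₂ / d₂) : ℝ) * ((m₁ : ℝ) * m₂) ^ (-(1 / 2 : ℝ)) *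
              ((∫ u₁ in Set.Ioi (0 : ℝ),
                  (Real.log (KMV2000.qhat q / ((d₁ * (m₂ / d₂ / (m₁ / d₁).gcd (m₂ / d₂)) : ℕ) : ℝ)) + Real.log u₁) ^ i *
                  ∫ u₂ in Set.Ioi (((((m₁ / (m₁ / d₁).gcd (m₂ / d₂)) * (m₂ / (m₁ / d₁).gcd (m₂ / d₂)) : ℕ) : ℝ) /
                      KMV2000.qhat q ^ 2) / u₁),
                    Real.exp (-(u₁ + u₂)) / (1 - Real.exp (-(u₁ + u₂))) ^ 2 *
                    (Real.log (KMV2000.qhat q / ((d₂ * (m₁ / d₁ / (m₁ / d₁).gcd (m₂ / d₂)) : ℕ) : ℝ)) + Real.log u₂) ^ j) -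
              ∑' l : ℕ, ((l : ℝ) + 1 + (min (q ^ 2 / (d₁ * (m₂ / d₂ / (m₁ / d₁).gcd (m₂ / d₂))))
                  (q ^ 2 / (d₂ * (m₁ / d₁ / (m₁ / d₁).gcd (m₂ / d₂)))) : ℕ))⁻¹ *
                KMV2000.logCutoffW i j
                  (Real.log (KMV2000.qhat q / ((d₁ * (m₂ / d₂ / (m₁ / d₁).gcd (m₂ / d₂)) : ℕ) : ℝ)) -
                    Real.log ((l : ℝ) + 1 + (min (q ^ 2 / (d₁ * (m₂ / d₂ / (m₁ / d₁).gcd (m₂ / d₂))))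
                      (q ^ 2 / (d₂ * (m₁ / d₁ / (m₁ / d₁).gcd (m₂ / d₂)))) : ℕ)))
                  (Real.log (KMV2000.qhat q / ((d₂ * (m₁ / d₁ / (m₁ / d₁).gcd (m₂ / d₂)) : ℕ) : ℝ)) -
                    Real.log ((l : ℝ) + 1 + (min (q ^ 2 / (d₁ * (m₂ / d₂ / (m₁ / d₁).gcd (m₂ / d₂))))
                      (q ^ 2 / (d₂ * (m₁ / d₁ / (m₁ / d₁).gcd (m₂ / d₂)))) : ℕ)))
                  (((((m₁ / (m₁ / d₁).gcd (m₂ / d₂)) * (m₂ / (m₁ / d₁).gcd (m₂ / d₂)) : ℕ) : ℝ) / KMV2000.qhat q ^ 2) *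
                    ((l : ℝ) + 1 + (min (q ^ 2 / (d₁ * (m₂ / d₂ / (m₁ / d₁).gcd (m₂ / d₂))))
                      (q ^ 2 / (d₂ * (m₁ / d₁ / (m₁ / d₁).gcd (m₂ / d₂)))) : ℕ)) ^ 2))) : ℝ) : ℂ) -
        ∑ m₂ ∈ Icc 1 ⌊KMV2000.qhat q ^ Δ'⌋₊,
          (KMV2000.mollifierCoeff P (KMV2000.qhat q ^ Δ') m₁ : ℂ) *
            (KMV2000.mollifierCoeff P (KMV2000.qhat q ^ Δ') m₂ : ℂ) *
          ∑ d₁ ∈ m₁.divisors, ∑ d₂ ∈ m₂.divisors,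
            (((((m₁ / d₁).gcd (m₂ / d₂) : ℝ) * ((m₁ : ℝ) * m₂) ^ (-(1 / 2 : ℝ)) *
              (∫ u₁ in Set.Ioi (0 : ℝ),
                  (Real.log (KMV2000.qhat q / ((d₁ * (m₂ / d₂ / (m₁ / d₁).gcd (m₂ / d₂)) : ℕ) : ℝ)) + Real.log u₁) ^ i *
                  ∫ u₂ in Set.Ioi (((((m₁ / (m₁ / d₁).gcd (m₂ / d₂)) * (m₂ / (m₁ / d₁).gcd (m₂ / d₂)) : ℕ) : ℝ) /
                      KMV2000.qhat q ^ 2) / u₁),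
                    Real.exp (-(u₁ + u₂)) / (1 - Real.exp (-(u₁ + u₂))) ^ 2 *
                    (Real.log (KMV2000.qhat q / ((d₂ * (m₁ / d₁ / (m₁ / d₁).gcd (m₂ / d₂)) : ℕ) : ℝ)) + Real.log u₂) ^ j)) : ℝ) : ℂ)) =
      -∑ m₁ ∈ Icc 1 ⌊KMV2000.qhat q ^ Δ'⌋₊, ∑ m₂ ∈ Icc 1 ⌊KMV2000.qhat q ^ Δ'⌋₊,
          (KMV2000.mollifierCoeff P (KMV2000.qhat q ^ Δ') m₁ : ℂ) *
            (KMV2000.mollifierCoeff P (KMV2000.qhat q ^ Δ') m₂ : ℂ) *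
          ∑ d₁ ∈ m₁.divisors, ∑ d₂ ∈ m₂.divisors,
            (((((m₁ / d₁).gcd (m₂ / d₂) : ℝ) * ((m₁ : ℝ) * m₂) ^ (-(1 / 2 : ℝ)) *
              ∑' l : ℕ, ((l : ℝ) + 1 + (min (q ^ 2 / (d₁ * (m₂ / d₂ / (m₁ / d₁).gcd (m₂ / d₂))))
                  (q ^ 2 / (d₂ * (m₁ / d₁ / (m₁ / d₁).gcd (m₂ / d₂)))) : ℕ))⁻¹ *
                KMV2000.logCutoffW i j
                  (Real.log (KMV2000.qhat q / ((d₁ * (m₂ / d₂ / (m₁ / d₁).gcd (m₂ / d₂)) : ℕ) : ℝ)) -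
                    Real.log ((l : ℝ) + 1 + (min (q ^ 2 / (d₁ * (m₂ / d₂ / (m₁ / d₁).gcd (m₂ / d₂))))
                      (q ^ 2 / (d₂ * (m₁ / d₁ / (m₁ / d₁).gcd (m₂ / d₂)))) : ℕ)))
                  (Real.log (KMV2000.qhat q / ((d₂ * (m₁ / d₁ / (m₁ / d₁).gcd (m₂ / d₂)) : ℕ) : ℝ)) -
                    Real.log ((l : ℝ) + 1 + (min (q ^ 2 / (d₁ * (m₂ / d₂ / (m₁ / d₁).gcd (m₂ / d₂))))
                      (q ^ 2 / (d₂ * (m₁ / d₁ / (m₁ / d₁).gcd (m₂ / d₂)))) : ℕ)))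
                  (((((m₁ / (m₁ / d₁).gcd (m₂ / d₂)) * (m₂ / (m₁ / d₁).gcd (m₂ / d₂)) : ℕ) : ℝ) / KMV2000.qhat q ^ 2) *
                    ((l : ℝ) + 1 + (min (q ^ 2 / (d₁ * (m₂ / d₂ / (m₁ / d₁).gcd (m₂ / d₂))))
                      (q ^ 2 / (d₂ * (m₁ / d₁ / (m₁ / d₁).gcd (m₂ / d₂)))) : ℕ)) ^ 2)) : ℝ) : ℂ) := by
    rw [← Finset.sum_neg_distrib]
    refine Finset.sum_congr rfl fun m₁ _ ↦ ?_
    rw [← Finset.sum_sub_distrib, ← Finset.sum_neg_distrib]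
    refine Finset.sum_congr rfl fun m₂ _ ↦ ?_
    rw [← mul_sub, ← Finset.sum_sub_distrib, ← mul_neg, ← Finset.sum_neg_distrib]
    congr 1
    refine Finset.sum_congr rfl fun d₁ _ ↦ ?_
    rw [← Finset.sum_sub_distrib, ← Finset.sum_neg_distrib]
    refine Finset.sum_congr rfl fun d₂ _ ↦ ?_
    rw [← Complex.ofReal_sub, ← Complex.ofReal_neg]
    congr 1
    ring
  rw [hdiff, mul_neg, norm_neg, norm_mul]
  have hblock := norm_blockTail_le hqh i j hAij hM (KMV2000.mollifierCoeff P (KMV2000.qhat q ^ Δ'))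
  have hcoeff : ‖(Q.coeff i : ℂ) * (Q.coeff j : ℂ) * (((Real.log (KMV2000.qhat q))⁻¹ : ℝ) : ℂ) ^ (i + j) *
          (1 + (-1 : ℂ) ^ (i + j)) * (KMV2000.qhat q : ℂ)‖ ≤
      |Q.coeff i| * |Q.coeff j| * (Real.log (KMV2000.qhat q))⁻¹ ^ (i + j) * 2 * KMV2000.qhat q := by
    have h2 : ‖(1 + (-1 : ℂ) ^ (i + j))‖ ≤ 2 := by
      calc ‖(1 + (-1 : ℂ) ^ (i + j))‖ ≤ ‖(1 : ℂ)‖ + ‖(-1 : ℂ) ^ (i + j)‖ := norm_add_le _ _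
        _ = 2 := by rw [norm_pow, norm_neg, norm_one, one_pow]; norm_num
    rw [norm_mul, norm_mul, norm_mul, norm_mul, Complex.norm_real, Complex.norm_real, norm_pow, Complex.norm_real,
      Complex.norm_real, Real.norm_eq_abs, Real.norm_eq_abs, Real.norm_of_nonneg hlog, Real.norm_of_nonneg hQ0.le]
    gcongr
  calc ‖(Q.coeff i : ℂ) * (Q.coeff j : ℂ) * (((Real.log (KMV2000.qhat q))⁻¹ : ℝ) : ℂ) ^ (i + j) *
          (1 + (-1 : ℂ) ^ (i + j)) * (KMV2000.qhat q : ℂ)‖ * _ ≤ (|Q.coeff i| * |Q.coeff j| * (Real.log (KMV2000.qhat q))⁻¹ ^ (i + j) * 2 * KMV2000.qhat q) *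
        ((∑ m ∈ Icc 1 ⌊KMV2000.qhat q ^ Δ'⌋₊, |KMV2000.mollifierCoeff P (KMV2000.qhat q ^ Δ') m| * (m.divisors.card : ℝ)) ^ 2 *
          KMV2000.qhat q ^ Δ' *
        (((∫ t in Set.Ioi (0 : ℝ), t ^ A * (Real.exp (-t) * (2 ^ i * (1 + |Real.log t| ^ i)))) *
            ∫ t in Set.Ioi (0 : ℝ), t ^ A * (Real.exp (-t) * (2 ^ j * (1 + |Real.log t| ^ j)))) *
          (1 + Real.log (KMV2000.qhat q) + 2 * Real.log (KMV2000.qhat q ^ Δ')) ^ i *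
            (1 + Real.log (KMV2000.qhat q) + 2 * Real.log (KMV2000.qhat q ^ Δ')) ^ j *
          (∑' n : ℕ, (((n : ℝ) + 1) ^ 2)⁻¹) *
          (KMV2000.qhat q ^ 2 * (KMV2000.qhat q ^ Δ') ^ 2 / ((q : ℝ)) ^ 4) ^ A * (((q : ℝ)) ^ 2 + 1) ^ ((i + j : ℝ) + 1))) := mul_le_mul hcoeff hblock (norm_nonneg _) (by positivity)
    _ = _ := by ring

end Summit.Parity.GeneralizedHardyLittlewood.Theorems.MomentsBeyondDiagonal.DiagLines

end
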